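import Literature.NumberTheory.Sieve.FordMaynardSieveBoundG1
import HarnessLib

/-!
# Route `FordMaynardSieveConst01651`, target `SieveConst01651` (stmt-Parity-19185), line `sieve_decomposition`,
# stub `stub_coneCertClosed`: the sign clause only sees subvectors of dimension `≤ 3`

Helper file (def-free) for conjunct (iv) of `stub_coneCertClosed` (K. Ford, J. Maynard, *On the theory of prime
producing sieves*, arXiv:2407.14368, Theorem 7.3 (a), §8.2): `starSum g₀ k x ≤ 0` for monotone `x ∈ ℋ_k`,
`2 ≤ k ≤ 6`.  Under the closed support clause of the certificate (`g₀,ᵣ(y) ≠ 0`, `y` monotone ⇒ `r = 0` or all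
`yᵢ > ν` and `|y| ≤ 1/2`) every subvector `x_A` of a box vector (`xᵢ > ν`) with `|A|·ν ≥ 1/2` contributes nothing:

* `apply_subvector_eq_zero_of_card` — `g₀ |A| (x_A) = 0` for monotone `x` with `xᵢ > ν ≥ 0` and `|A| ν ≥ 1/2`;
* `starSum_eq_sum_filter_card` — `(𝟙⋆g₀)(x) = ∑_{A : |A|·ν < 1/2} g₀ |A| (x_A)`; at `ν = 0.1651` only `|A| ≤ 3`
  (`starSum_eq_sum_card_le_three_01651`): for `k = 6` the sign check reads `1 + 6 + 15 + 20 = 42` table look-ups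
  per point instead of `64`, and no data of dimension `≥ 4` is ever consulted.

References: [FordMaynard2024PrimeSieves] arXiv:2407.14368, Definition 7.1, (7.1), §8.2 ("at most three components").
-/

noncomputable section

open Finset
open scoped Classical
open Literature.NumberTheory.Sieve Literature.NumberTheory.Sieve.FordMaynard

namespace Summit.Parity.GeneralizedHardyLittlewood.FordMaynardSieveConst01651SieveConst01651

/-- A subvector `x_A` (increasing enumeration) of a monotone box vector is monotone, boxed, and has sum `> |A|·ν`;
so under the closed support clause `g₀ |A| (x_A) = 0` once `|A|·ν ≥ 1/2`.
[cite: FordMaynard2024PrimeSieves, (7.1) (support of 𝒢₁: |y| ≤ 1/2)] -/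
theorem apply_subvector_eq_zero_of_card {ν : ℝ} {g₀ : VecFn}
    (hsupp : ∀ (r : ℕ) (y : Fin r → ℝ), Monotone y → g₀ r y ≠ 0 → r = 0 ∨ ((∀ i, ν < y i) ∧ ∑ i, y i ≤ 1 / 2))
    {k : ℕ} {x : Fin k → ℝ} (hx : Monotone x) (hbox : ∀ i, ν < x i) (A : Finset (Fin k))
    (hA : 1 / 2 ≤ (A.card : ℝ) * ν) :
    g₀ A.card (fun i => x (A.orderEmbOfFin rfl i)) = 0 := by
  by_contra hne
  have hmono : Monotone (fun i => x (A.orderEmbOfFin rfl i)) := hx.comp (A.orderEmbOfFin rfl).monotone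
  rcases hsupp _ _ hmono hne with h0 | ⟨-, hsum⟩
  · rw [h0] at hA; norm_num at hA
  · have hpos : 0 < A.card := by
      by_contra h
      push Not at h
      have : A.card = 0 := by omega
      rw [this] at hA; norm_num at hA
    have hlt : (A.card : ℝ) * ν < ∑ i : Fin A.card, x (A.orderEmbOfFin rfl i) := by
      calc (A.card : ℝ) * ν = ∑ _i : Fin A.card, ν := by simp
        _ < ∑ i : Fin A.card, x (A.orderEmbOfFin rfl i) := by
          refine Finset.sum_lt_sum_of_nonempty ?_ (fun i _ => hbox _)
          rw [Finset.univ_nonempty_iff]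
          exact ⟨⟨0, hpos⟩⟩
    linarith

/-- **The subvector sum only runs over `|A|·ν < 1/2`.** For monotone box vectors `x` and cone data with the closed
support clause, `(𝟙⋆g₀)(x) = ∑_{A ⊆ [k], |A|·ν < 1/2} g₀ |A| (x_A)`.
[cite: FordMaynard2024PrimeSieves, Definition 7.1 and (7.1)] -/
theorem starSum_eq_sum_filter_card {ν : ℝ} {g₀ : VecFn}
    (hsupp : ∀ (r : ℕ) (y : Fin r → ℝ), Monotone y → g₀ r y ≠ 0 → r = 0 ∨ ((∀ i, ν < y i) ∧ ∑ i, y i ≤ 1 / 2))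
    {k : ℕ} {x : Fin k → ℝ} (hx : Monotone x) (hbox : ∀ i, ν < x i) :
    starSum g₀ k x = ∑ A ∈ (Finset.univ : Finset (Finset (Fin k))).filter (fun A => (A.card : ℝ) * ν < 1 / 2),
      g₀ A.card (fun i => x (A.orderEmbOfFin rfl i)) := by
  unfold starSum
  rw [← Finset.sum_filter_add_sum_filter_not Finset.univ (fun A : Finset (Fin k) => (A.card : ℝ) * ν < 1 / 2)]
  conv_rhs => rw [← add_zero (Finset.sum _ _)]
  congr 1
  refine Finset.sum_eq_zero fun A hA => ?_
  have hA' : 1 / 2 ≤ (A.card : ℝ) * ν := by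
    have := (Finset.mem_filter.1 hA).2
    push Not at this
    exact this
  exact apply_subvector_eq_zero_of_card hsupp hx hbox A hA'

/-- **At `ν₀ = 0.1651` only subvectors of dimension `≤ 3` matter**: for monotone `x` with all `xᵢ > ν₀` and cone
data with the closed support clause at `ν₀`, `(𝟙⋆g₀)(x) = ∑_{A ⊆ [k], |A| ≤ 3} g₀ |A| (x_A)` (`4ν₀ = 0.6604 > 1/2`).
[cite: FordMaynard2024PrimeSieves, §8.2 ("there can be at most three components")] -/
theorem starSum_eq_sum_card_le_three_01651 {g₀ : VecFn}
    (hsupp : ∀ (r : ℕ) (y : Fin r → ℝ), Monotone y → g₀ r y ≠ 0 →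
      r = 0 ∨ ((∀ i, (1651 / 10000 : ℝ) < y i) ∧ ∑ i, y i ≤ 1 / 2))
    {k : ℕ} {x : Fin k → ℝ} (hx : Monotone x) (hbox : ∀ i, (1651 / 10000 : ℝ) < x i) :
    starSum g₀ k x = ∑ A ∈ (Finset.univ : Finset (Finset (Fin k))).filter (fun A => A.card ≤ 3),
      g₀ A.card (fun i => x (A.orderEmbOfFin rfl i)) := by
  rw [starSum_eq_sum_filter_card hsupp hx hbox]
  congr 1
  ext A
  simp only [Finset.mem_filter, Finset.mem_univ, true_and]
  constructor
  · intro h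
    by_contra hle
    push Not at hle
    have : (4 : ℝ) ≤ A.card := by exact_mod_cast hle
    nlinarith
  · intro h
    have : (A.card : ℝ) ≤ 3 := by exact_mod_cast h
    nlinarith

end Summit.Parity.GeneralizedHardyLittlewood.FordMaynardSieveConst01651SieveConst01651

end
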